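import Mathlib
import Summits.Ventures.PercRepro2.SevenTypedDomBridge
import Summits.Ventures.PercRepro2.SevenTypedDomCover
import Summits.Ventures.PercRepro2.TypedBundleTower

/-!
# Seven typed edges, XIII.D: ROW 2′TRI ON THE DOMAIN OF RECORD WITH SEVEN TYPED EDGES (blind cell PercRepro2,
night-3 g9, 2026-08-25)

**`typedCount_nonneg_of_domain_card_seven`**: every instance of the domain of record
`ResidualCoreNHatCTBRASUDO` (the eleven conditions: `ResidualCore`, `¬Hats`, `¬HasRootCut`, `¬HasTwoTerminalPart`,
`¬HasRootBundle`, `¬HasCutRoots`, `¬HasCutRootsA3`, `¬OneStar`, `¬MildInst`, `o ≠ b`, `¬OBehindA3`) with exactly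
SEVEN typed edges has a nonnegative typed base, UNCONDITIONALLY — the `#F = 7` leaves of the sentence of record,
discharged for p2's four-line composition (the layer «8 ≤ #F»).

METHOD (not the pointwise-on-states method of NEG-150 — «the pointwise-on-states method is exhausted beyond the
composed layers; a further class theorem needs a NON-POINTWISE mechanism»): the ladder's finite rung, restricted
to the domain of record.  The reduced sorted labellings of the nineteen points with seven typed edges are
enumerated in the kernel (`SevenTypedAbstract`, `allOk7`); at every full leaf the leaf test `okQ7Dom`
(`SevenTypedDomLeaf`) first applies a label / state GUARD that certifies the instance is OUTSIDE the domain — a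
mark `a₁, a₂, o, b` of typed degree `0` (`markDegOK7`, against `ResidualCore.residual.deg_*`), the roots not
connected in the typed graph (the all-open state `127` fails `Q`, against `ResidualCon.con`), or every
configuration mild (`mildIdx` on the `128` state indices, against `¬MildInst`) — and otherwise runs the `128` cube
tests of g8's rung (`okTab7A … okTab7D`, the placement sums of the kernel `K₃` on the state indices, closed by the
`tst7_bridge_n` of `SevenTypedPerm1–16`).  Of the `4,829` reduced labellings, `1,673` are tested, the rest are
excluded by the guards (the guards are PROVED sound in `SevenTypedDomCore` / `SevenTypedDomBridge` /
`SevenTypedDomTransfer`, not assumed).  The finite statement `allOk7 okQ7Dom = true` is `allOk7Dom_true`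
(`SevenTypedDomCover`, the `252` kernel groups `SevenTypedDomShards*` / `SevenTypedDomJoin*`).
-/

namespace Summit.Ventures.PercRepro2

open UnionCluster

namespace CovForm

namespace TwoTyped

open OneTyped TypedRed

section All7D

variable {V : Type*} {E : Type*} [DecidableEq V] [Fintype E] [DecidableEq E] {R : Type*} [Field R]
  [LinearOrder R] [IsStrictOrderedRing R]
variable (ends : E → Sym2 V) (o a₁ a₂ a₃ b : V)

/-- **Row 2′TRI with seven typed edges on the guarded reduced class, unconditional**: marks distinct up to
`b = a₃` / `o = b`, reduced, the marks `a₁, a₂, o, b` of typed degree `≥ 1`, the roots connected in the typed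
graph, not mild. -/
theorem typedCount_nonneg_of_dom_card_seven' (hm : MarksDistinct o a₁ a₂ a₃ b)
    (F : Finset E) (hF : F.card = 7) (hred : Reduced ends o a₁ a₂ a₃ b F) (τ : E → ℕ)
    (hτ : ∀ e ∈ F, τ e = 1 ∨ τ e = 2)
    (hcon : Conn ends (TypedRed.typedConfig F) a₁ a₂)
    (hmild : ¬ RootBridge.MildInst ends o a₁ a₂ a₃ b F (fun _ => false))
    (hd1 : ∃ f ∈ F, a₁ ∈ ends f) (hd2 : ∃ f ∈ F, a₂ ∈ ends f) (hdo : ∃ f ∈ F, o ∈ ends f)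
    (hdb : ∃ f ∈ F, b ∈ ends f) :
    0 ≤ typedCount F (fun _ => false) τ (K3 ends o a₁ a₂ a₃ b : Config E → Config E → Config E → R) :=
  typedCount_nonneg_of_dom_card_seven ends o a₁ a₂ a₃ b allOk7Dom_true hm F hF hred τ hτ hcon hmild hd1 hd2
    hdo hdb

/-- **ROW 2′TRI ON THE DOMAIN OF RECORD WITH SEVEN TYPED EDGES** (`z ≡ false`): every instance of
`ResidualCoreNHatCTBRASUDO` with `F.card = 7` has a nonnegative typed base — the `#F = 7` leaves of the sentence of
record closed by the domain-restricted finite rung (see the module docstring for the method). -/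
theorem typedCount_nonneg_of_domain_card_seven (F : Finset E)
    (h : ResidualCoreNHatCTBRASUDO ends o a₁ a₂ a₃ b F) (hF : F.card = 7) (τ : E → ℕ)
    (hτ : ∀ e ∈ F, τ e = 1 ∨ τ e = 2) :
    0 ≤ typedCount F (fun _ => false) τ (K3 ends o a₁ a₂ a₃ b : Config E → Config E → Config E → R) := by
  have hU := h.coreNHatCTBRASUD.coreNHatCTBRASU
  have hcore : ResidualCore ends o a₁ a₂ a₃ b F :=
    hU.coreNHatCTBRAS.coreNHatCTBRA.coreNHatCTBR.coreNHatCTB.coreNHatC.coreNHat.core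
  have hres := hcore.residualConR.residualCon.residual
  exact typedCount_nonneg_of_dom_card_seven' ends o a₁ a₂ a₃ b hcore.marks F hF hres.reduced τ hτ
    hcore.residualConR.residualCon.con hU.not_mild hres.deg_a1 hres.deg_a2 hres.deg_o hres.deg_b

end All7D

end TwoTyped

end CovForm

end Summit.Ventures.PercRepro2
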